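/-
Copyright (c) 2026 the pub-hodgecm-mathlib formalisation cell (harness21).  Prover seat hodgecm-mathlib-B-p04 (g61), req618 STAGE 1a «FOUR-FRAME» squad (director s1808;
LEAD directive T17-27 b9ecbbedecc9c5ae D3 day 1): the TOKENS of the sheet of record `SIGSHEET-DRAM-FourFrame.v2` (LH4-plan (g9), sha16 c03c627160493264) §H, VERBATIM,
+ §A items A-0∕A-1 VERBATIM and A-2 in the sheet-v3 wording (explicit `Connected` hypothesis, LEAD T17-26 (r1)), as the one tree vocabulary module the three unit-(i) ports (A-0 module criterion, A-1 defect-module shape, A-2↑ axis exponent ≤ tree distance)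
import — OFFERED to the dealer LH4-plan (g10) as the Literature NOTIONS half of its deal g10-#0 «DEFS-1» (WORD #1 19:28:32Z; LEAD T17-28 (D2′) split), at the
dealer's path `Literature/NumberTheory/Automorphic/UnitaryThreeFourFrameDefs.lean` and namespace `Literature.NumberTheory.Automorphic.UnitaryThreeFourFrame`.  2026-09-03.
-/
import Literature.NumberTheory.Automorphic.UnitaryLatticeTreeDefs            -- ★ `IsVertexLattice`, `IsVertex`, `latt`, `mapGL`, `latticeGraph`, `pairing`, `StdForm.antidiagonal`
import Mathlib.Combinatorics.SimpleGraph.Metric                               -- `SimpleGraph.dist`, `SimpleGraph.Connected` (A-2)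
import HarnessLib

/-!
# Four-frame tokens for the fixed-vertex census of a near-identity regular elliptic element on the `U(3)` lattice tree at `Φ₃` — DEFINITIONS AND THE THREE UNIT-(i) NAMED STATEMENTS

Topic `NumberTheory/Automorphic`; namespace `Literature.NumberTheory.Automorphic.UnitaryThreeFourFrame` (dealer WORD #1 g10-#0).  PLAIN `def`s WITH BODIES (census function, frame
projections, the four frames, the frame element `γ_b`, defect sets, axis stability, the place ∕ element data, two parameter schedules) and the three unit-(i) statements A-0∕A-1∕A-2 as named `Prop`s; NO theorem, NO
`sorry`, NO `instance`, NO notation.  Cell `pub/hodgecm-mathlib` (D-0151), crux H413 = `stmt-HodgeConjecture-24833`, organ (D-RAM) `stub_DyRamCore` (leaf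
`Cruxes/H413/Lines/F0_P3c_DyadicPaydown.lean` ED. 4 :147), «FOUR-FRAME» road (socket certificate of record v1.1 `dyRamCore_of_fourFrame`, one fused input `RankTransferWild`).

THE SETTING ([Rogawski1990, §4.9 Prop. 4.9.1 (a) p. 55]; [Kottwitz1986, §3]; [LanglandsShelstad1989, Thm. p. 484]).  `K` is a field with `Valued K ℤᵐ⁰` (the local CM
completion `E = L_w`), `σ : K →+* K` the conjugation of `E ∕ F`, `Φ₃ = antidiag(1,1,1)` = ★ `(StdForm.antidiagonal 3).over K`.  A regular elliptic `γ ∈ U(Φ₃)(F)` near `1`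
with eigenvalues `α, β, 1 ∈ E¹` is diagonal in a `Φ₃`-orthogonal FRAME `(f₁, f₂, f₃)`; the four `U(Φ₃)(F)`-classes inside its stable class are indexed by the norm classes
`(ω N(f₁), ω N(f₂)) ∈ {±1}²` of the frame (H4 `signPair`, H7 `IsFourFrameFamily`), and in frame `b` the element is `γ_b = 1 + (α−1)π₁ + (β−1)π₂` (H3 `frameProj`, H8 `frameElt`).
The local transfer identity [LS₂] at a dyadic ramified place compares the κ-weighted numbers of `γ_b`-fixed vertices of the ★ `latticeGraph` (H2 `fixedVertexCount`) across the
four frames; the bookkeeping objects of that census are the DEFECT SET `M_Λ = {(δ₁, δ₂) | (δ₁π₁ + δ₂π₂)Λ ⊆ Λ}` (H12 `defectSet`) and AXIS STABILITY `ϖ^c π Λ ⊆ Λ` (H13 `AxisStable`):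
`γ_b Λ = Λ ⟺ (α−1, β−1) ∈ M_Λ` is the module criterion (sequel file `UnitaryThreeFourFrameModuleCriterion`, over ★ `mapGL_eq_iff_map_toLin'_le`).

TOKENS (numbering of the sheet of record v2 §H, bodies byte-identical): H1 `normSign` · H2 `fixedVertexCount` · H3 `frameProj` · H4 `signPair` · H5 `kappaChar` · H6 `baseSign` ·
H7 `IsFourFrameFamily` · H8 `frameElt` · H9 `fPart` · H10 `fPartProd` · H11 `ampl` · H12 `defectSet` · H13 `AxisStable` · D `IsRamifiedQuadraticDatum` · E `IsElementDatum` ·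
P1 `depthOfRecord` · P2 `tauOfRecord`.  The symbols `v1.4 §…` in the docstrings refer to the cell's census memo of record (evidence file, not a source of truth for Lean).

NAMED STATEMENTS (sheet v2 §A, bodies byte-identical): A-0 `ModuleCriterion` (`γ_bΛ = Λ ⟺ (α−1, β−1) ∈ M_Λ^{(b)}`; discharged by the sequel file
`UnitaryThreeFourFrameModuleCriterion`, theorem `moduleCriterion_holds`) and A-1 `DefectModuleShape` (`M_Λ = 𝔭^{c₁} ⊕ 𝔭^{c₂} + 𝒪(ϖ^{c₁−k}u, ϖ^{c₂−k})`; discharged by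
its own sequel file, theorem `defectModuleShape_holds`) — both elementary rank-≤-3 module algebra over `𝒪`, proved in-house (HOME certificates c9892035ba7f5d54 ∕ abad451e204113eb) —
and A-2 `AxisExponentEqTreeDistance` in the SHEET v3 WORDING (v2 body + the explicit hypothesis `(latticeGraph σ ϖ Φ₃).Connected`, LEAD T17-26 (r1); its `≤` half is the tree
theorem ★ `axisExponent_le_dist_antidiagonal`, the `≥` half (A-2↓) is owed from unit (ii-0)).

NOT HERE (deliberately): the census LAW Props (stable law, κ-amplitude, κ-sign — EMPIRICAL census laws of record, NOT literature facts: they live with their place-wise cuts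
(S1), the fence (S2), `RankTransferWild` and the dictionary Props in the SUMMIT-SIDE law-defs module of the line, LEAD T17-28 (D2′)), any theorem.  HONEST LABEL: HC_CM is proved only modulo the 7 printed citations (2 remaining named inputs: hLiu418 =
stmt-HodgeConjecture-24832, h413 = stmt-HodgeConjecture-24833) until rung 0 closes; this file asserts nothing.
-/

noncomputable section

open scoped Valued WithZero Matrix MatrixGroups
open Finset Classical

namespace Literature.NumberTheory.Automorphic.UnitaryThreeFourFrame

open Literature.NumberTheory.Automorphic Literature.NumberTheory.Automorphic.HermitianLattice
  Literature.NumberTheory.Automorphic.UnitaryLatticeTree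

/-! ## §H  Helper tokens (plain `def`s; census functions, frames, v1.4 symbols) — sheet of record v2 §H verbatim -/

section Helpers

variable {K : Type} [Field K] [Valued K ℤᵐ⁰]

/-- H1 · `ω(x) = ω_{E∕F}(x)`, the NORM-CLASS SIGN of `x ∈ F^× = (K^σ)^×`: `+1` iff `x = z·σz ∈ N(E^×)`, else `−1`.  (For the genuine local field this is
the Hilbert symbol `(x, D)_F` of ★ `hilbertSymbol` (`Literature.NumberTheory.QuadraticForms.HilbertSymbol`, O'Meara §63B); not used directly because
`F = K^σ` is not a type in the ★ lattice currency.)  v1.4 §1∕§3 symbol `ω`. [cite: Rogawski1990, §4.9 p. 55] -/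
def normSign (σ : K →+* K) (x : K) : ℤ := if ∃ z : K, z * σ z = x then 1 else -1

/-- H2 · CENSUS FUNCTION `n_t(T) = #{type-t vertices Λ of the ★ tree of (K³, Φ₃) with TΛ = Λ}` — ★ `IsVertexLattice σ ϖ Φ₃ t`, ★ `mapGL`, `Set.ncard`
(so a statement giving it a positive value also asserts finiteness).  v1.4 §0 "fixed count", vertex type `t ∈ {0, 2}` (T17-06 vocabulary). [cite: Rogawski1990, §4.9 Prop. 4.9.1 (a) p. 55] [cite: Kottwitz1986, §3] -/
def fixedVertexCount (σ : K →+* K) (ϖ : K) (t : ℕ) (T : GL (Fin 3) K) : ℕ :=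
  {M : Submodule 𝒪[K] (Fin 3 → K) | IsVertexLattice σ ϖ ((StdForm.antidiagonal 3).over K) t M ∧ mapGL T M = M}.ncard

/-- H3 · FRAME PROJECTION `π_f = f·f^*Φ₃ ∕ N(f)`, `N(f) = Φ₃(f,f)` = ★ `pairing σ Φ₃ f f`: the matrix `x ↦ f·⟨f, x⟩∕N(f)` (v1.4 §0 `π_i`; `law/frames.py proj_matrices`). [cite: Jacobowitz1962, §4] [cite: Kottwitz1986, §3] -/
def frameProj (σ : K →+* K) (f : Fin 3 → K) : Matrix (Fin 3) (Fin 3) K :=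
  (pairing σ ((StdForm.antidiagonal 3).over K) f f)⁻¹ •
    Matrix.vecMulVec f (Matrix.vecMul (fun m => σ (f m)) ((StdForm.antidiagonal 3).over K))

/-- H4 · THE FRAME INDEX `b : Fin 4 ↦ (ε₁, ε₂) ∈ {±1}²` EXACTLY as v1.4 §1∕§3 and `law/frames.py`: `0 ↦ (+,+)` = the base frame `b₀` (classes
`(1, 1, ω(−1))`), `1 ↦ (+,−)`, `2 ↦ (−,+)`, `3 ↦ (−,−)`; at `ℚ₂(√2)` these are the frames with norms `(1,2,−2), (1,6,−6), (3,−2,6), (3,−3,1)`. [cite: Rogawski1990, §4.9 p. 55] -/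
def signPair (b : Fin 4) : ℤ × ℤ := (![(1, 1), (1, -1), (-1, 1), (-1, -1)] : Fin 4 → ℤ × ℤ) b

/-- H5 · THE κ-WEIGHTS `κ_i(b)`, `i : Fin 3` (`0 ↔ slot 1 (α) ↔ κ₁ = κ(ε₁)`, `1 ↔ slot 2 (β) ↔ κ₂ = κ(ε₂)`, `2 ↔ slot 3 ↔ κ₃ = κ₁κ₂ = κ(ε₁ε₂)`):
the three non-trivial characters of `(ℤ∕2)²` evaluated at frame `b` (v1.4 §3; `law/frames.py chars`). [cite: Rogawski1990, §4.9 p. 55] -/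
def kappaChar (i : Fin 3) (b : Fin 4) : ℤ := (![(signPair b).1, (signPair b).2, (signPair b).1 * (signPair b).2] : Fin 3 → ℤ) i

/-- H6 · `κ_i(b₀)` IN v1.4's SIGN LAW = the norm class of `N(f_i^{(b₀)})` at the base frame = `(1, 1, ω(−1))_i` (v1.4 §3 SIGN: "c₁ = c₂ = +1 and c₃ = ω(−1) = κ₃(b₀)"). [cite: Rogawski1990, §4.9 p. 55] -/
def baseSign (σ : K →+* K) (i : Fin 3) : ℤ := (![(1 : ℤ), 1, normSign σ (-1)] : Fin 3 → ℤ) i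

/-- H7 · A FOUR-FRAME FAMILY AT Φ₃: `f b = (f₁, f₂, f₃)` is a Φ₃-ORTHOGONAL basis (`Φ₃(f_i, f_j) = 0`, `N(f_i) ≠ 0`) with NORM CLASSES
`(ω N(f₁), ω N(f₂)) = signPair b` and `ω N(f₃) = ω(−1)·ε₁ε₂` (det constraint `ε₁ε₂ε₃ = ω(−1)`, v1.4 §1) — the four `G(F)`-classes
`ker(H¹(F,T) → H¹(F,G)) ≅ (ℤ∕2)²` in the stable class realised as frames. [cite: Jacobowitz1962, §4] [cite: Rogawski1990, §4.9 p. 55] -/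
def IsFourFrameFamily (σ : K →+* K) (f : Fin 4 → Fin 3 → (Fin 3 → K)) : Prop :=
  ∀ b : Fin 4,
    (∀ i j : Fin 3, i ≠ j → pairing σ ((StdForm.antidiagonal 3).over K) (f b i) (f b j) = 0) ∧
    (∀ i : Fin 3, pairing σ ((StdForm.antidiagonal 3).over K) (f b i) (f b i) ≠ 0) ∧
    normSign σ (pairing σ ((StdForm.antidiagonal 3).over K) (f b 0) (f b 0)) = (signPair b).1 ∧
    normSign σ (pairing σ ((StdForm.antidiagonal 3).over K) (f b 1) (f b 1)) = (signPair b).2 ∧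
    normSign σ (pairing σ ((StdForm.antidiagonal 3).over K) (f b 2) (f b 2)) = normSign σ (-1) * (signPair b).1 * (signPair b).2

/-- H8 · THE ELEMENT IN FRAME `b`: `γ_b = 1 + (α−1)·π₁^{(b)} + (β−1)·π₂^{(b)}` (v1.4 §0; `= diag(α, β, 1)` in the basis `f b`). [cite: Kottwitz1986, §3] [cite: Rogawski1990, §4.9 p. 55] -/
def frameElt (σ : K →+* K) (f : Fin 4 → Fin 3 → (Fin 3 → K)) (b : Fin 4) (α β : K) : Matrix (Fin 3) (Fin 3) K :=
  1 + (α - 1) • frameProj σ (f b 0) + (β - 1) • frameProj σ (f b 1)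

/-- H9 · THE F-PART `x_ij` (v1.4 §3 SIGN): `λ_i − λ_j = x_ij·√(λ_iλ_j)·√D` with the CANONICAL near-identity roots `l = (√α, √β, 1)`,
`λ = l²`, `√(λ_iλ_j) = l_i l_j`, `√D = δ` a skew element (`σδ = −δ`): `x_ij = (l_i² − l_j²)∕(l_i l_j δ) ∈ F`. [cite: Rogawski1990, §4.9 p. 55] -/
def fPart (δ : K) (l : Fin 3 → K) (i j : Fin 3) : K := (l i * l i - l j * l j) / (l i * l j * δ)

/-- H10 · `Π_{j≠i} x_ij` (v1.4 §3 SIGN; for slot `i` the two roots through `i`).  REMARK (LH4-plan): `x_ij·x_ik = −r_{ji}·r_{ik}∕D` with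
`r_{ij} = l_iσl_j − l_jσl_i`, and `ω(−D) = 1`, so `ω(Π_{j≠i} x_ij) = ω(r_{ji} r_{ik})` is `δ`-free (SIGSHEET v1 form; same number). [cite: Rogawski1990, §4.9 p. 55] -/
def fPartProd (δ : K) (l : Fin 3 → K) (i : Fin 3) : K :=
  fPart δ l i ((![1, 0, 0] : Fin 3 → Fin 3) i) * fPart δ l i ((![2, 2, 1] : Fin 3 → Fin 3) i)

/-- H11 · THE AMPLITUDE TOKEN `4(q^k − q^{k−B})⁺∕(q − 1)` over `ℚ`, `⁺ = max(0, ·)` EXPLICIT, `B ∈ ℤ` (v1.4 §3 (K); `B ≤ 0 ⇒ 0`). [cite: Rogawski1990, §4.9 Prop. 4.9.1 (a) p. 55] -/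
def ampl (q k : ℕ) (B : ℤ) : ℚ := 4 * max 0 ((q : ℚ) ^ (k : ℤ) - (q : ℚ) ^ ((k : ℤ) - B)) / ((q : ℚ) - 1)

/-- H12 · DEFECT SET of a lattice `Λ` in frame `b`: `M_Λ = {(δ₁, δ₂) ∈ E² | (δ₁π₁^{(b)} + δ₂π₂^{(b)})Λ ⊆ Λ}` (v1.4 §2 (A)). [cite: Kottwitz1986, §3] -/
def defectSet (P₁ P₂ : Matrix (Fin 3) (Fin 3) K) (Λ : Submodule 𝒪[K] (Fin 3 → K)) : Set (K × K) :=
  {δ | Λ.map ((Matrix.toLin' (δ.1 • P₁ + δ.2 • P₂)).restrictScalars 𝒪[K]) ≤ Λ}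

/-- H13 · `ϖ^c·π Λ ⊆ Λ` (axis stability of `Λ` for the projection `π` at exponent `c`); the AXIS EXPONENT `c_i(Λ)` is the least such `c` (v1.4 §2 `c_i`). [cite: Kottwitz1986, §3] [cite: Serre1980Trees, Ch. II §1.1] -/
def AxisStable (ϖ : K) (P : Matrix (Fin 3) (Fin 3) K) (Λ : Submodule 𝒪[K] (Fin 3 → K)) (c : ℕ) : Prop :=
  Λ.map ((Matrix.toLin' (ϖ ^ c • P)).restrictScalars 𝒪[K]) ≤ Λ

/-- D · THE PLACE DATUM (v1.4 §0): `σ` an involution with `v∘σ = v` (so `F = K^σ`), `ϖ` a uniformiser of `E = K` (`v ϖ = exp(−1)`), RAMIFIED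
(`σ`-fixed elements have even valuation), `d = v_E(ϖ − σϖ) = v_E(𝔇_{E∕F}) ≥ 1` (`1` tame, `2` R-U, `3` R-P at `F = ℚ₂`), `t = v_E(2)` (`0` off `2`,
`2` at `F = ℚ₂`); `q = #𝓀[K] = #k_E = #k_F`.  NO `σϖ = −ϖ` (fails at R-U) and NO `IsUnit 2`: ONE datum for tame ∕ R-P ∕ R-U.
The laws below also bind `[CompleteSpace K]` (so that `ω` of H1 is the LOCAL norm class) and `[Fintype 𝓀[K]]`. [cite: Jacobowitz1962, §5] [cite: Rogawski1990, §4.9 p. 55] -/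
def IsRamifiedQuadraticDatum (σ : K →+* K) (ϖ : K) (d t : ℕ) : Prop :=
  (∀ x, σ (σ x) = x) ∧ (∀ a, Valued.v (σ a) = Valued.v a) ∧ Valued.v ϖ = WithZero.exp (-1 : ℤ) ∧
  (∀ x : K, σ x = x → x ≠ 0 → ∃ n : ℤ, Valued.v x = WithZero.exp (2 * n)) ∧
  Valued.v (ϖ - σ ϖ) = Valued.v ϖ ^ d ∧ 1 ≤ d ∧ Valued.v (2 : K) = Valued.v ϖ ^ t

/-- E · THE ELEMENT DATUM (v1.4 §0∕§3, T17-06 (G4)): `α, β ∈ E¹` (`ασα = ββσβ = 1`), REGULAR (`α ≠ β`, `α ≠ 1`, `β ≠ 1`), NEAR THE IDENTITY with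
named threshold `N₀` on the ROOT DEPTHS `n₁ = v(β−1)`, `n₂ = v(α−1)`, `n₃ = v(α−β)` (v1.4: "`n_i` = the root depth NOT involving slot `i`"),
so that `v_E(D_γ) = n₁ + n₂ + n₃`, `D_γ = (α−β)(α−1)(β−1)`; the key `(v(α−β), v(α−1), v(β−1)) = (n₃, n₂, n₁)`. [cite: Rogawski1990, §4.9 p. 55] -/
def IsElementDatum (σ : K →+* K) (ϖ : K) (N₀ : ℕ) (α β : K) (n₁ n₂ n₃ : ℕ) : Prop :=
  α * σ α = 1 ∧ β * σ β = 1 ∧ α ≠ β ∧ α ≠ 1 ∧ β ≠ 1 ∧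
  Valued.v (β - 1) = Valued.v ϖ ^ n₁ ∧ Valued.v (α - 1) = Valued.v ϖ ^ n₂ ∧ Valued.v (α - β) = Valued.v ϖ ^ n₃ ∧
  N₀ ≤ n₁ ∧ N₀ ≤ n₂ ∧ N₀ ≤ n₃

/-- P1 · v1.4's NEAR-IDENTITY THRESHOLD `d₀` as a schedule in `d`: `d₀ = 1` (tame, `d = 1`), `3` (R-P, `d = 3`), `4` (R-U, `d = 2`) — i.e. `d` for odd `d`,
`d + 2` for even `d`.  (LH4-plan's data note: 6 extra R-U rows of depth `2 = d` at `ℚ₂(i)` also fit ⇒ alternative schedule `fun d => d`.) [cite: Rogawski1990, §4.9 p. 55] -/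
def depthOfRecord (d : ℕ) : ℕ := if d % 2 = 1 then d else d + 2

/-- P2 · v1.4's FITTED vertex-type-2 shift `τ` as a schedule in `d`: `−1` (tame, R-P: `d` odd), `+1` (R-U: `d` even).  A PARAMETER of the laws, not baked in. [cite: Rogawski1990, §4.9 p. 55] -/
def tauOfRecord (d : ℕ) : ℤ := if d % 2 = 1 then -1 else 1

end Helpers

/-! ## §A  The module criterion, the defect-module shape, axis exponent = tree distance (v1.4 §2 (A); desk price unit (i)) — sheet of record v2 §A items A-0, A-1 verbatim, A-2 in the v3 wording (named statements) -/

/-- A-0 · MODULE CRITERION (v1.4 §2): in each frame `b` and for EVERY lattice `Λ = latt g`: `γ_bΛ = Λ ⟺ (α − 1, β − 1) ∈ M_Λ^{(b)}`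
(`γ_b − 1 = (α−1)π₁ + (β−1)π₂`, `det γ_b = αβ` a unit).  Exact and elementary.  NAMED STATEMENT; discharged by `moduleCriterion_holds` (sequel file
`UnitaryThreeFourFrameModuleCriterion`). [cite: Kottwitz1986, §3] [cite: Rogawski1990, §4.9 Prop. 4.9.1 (a) p. 55] -/
def ModuleCriterion : Prop :=
  ∀ {K : Type} [Field K] [Valued K ℤᵐ⁰] (σ : K →+* K), (∀ x, σ (σ x) = x) → (∀ a, Valued.v (σ a) = Valued.v a) →
    ∀ (f : Fin 4 → Fin 3 → (Fin 3 → K)), IsFourFrameFamily σ f →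
    ∀ (α β : K), α * σ α = 1 → β * σ β = 1 →
    ∀ (b : Fin 4) (Γ : GL (Fin 3) K), (Γ : Matrix (Fin 3) (Fin 3) K) = frameElt σ f b α β →
    ∀ g : GL (Fin 3) K,
      mapGL Γ (latt (g : Matrix (Fin 3) (Fin 3) K)) = latt (g : Matrix (Fin 3) (Fin 3) K) ↔
        (α - 1, β - 1) ∈ defectSet (frameProj σ (f b 0)) (frameProj σ (f b 1)) (latt (g : Matrix (Fin 3) (Fin 3) K))

/-- A-1 · DEFECT MODULE SHAPE (v1.4 §2): for every lattice `Λ = latt g` and frame `b` there are the axis exponents `c₁ c₂`, a glue depth `k` and the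
GLUING UNIT `u_Λ` (a unit, determined mod `𝔭^k`) with `M_Λ^{(b)} = 𝔭^{c₁} ⊕ 𝔭^{c₂} + 𝒪_E·(ϖ^{c₁−k}u_Λ, ϖ^{c₂−k})` (exponents in `ℤ`).  Rank-2 module algebra.  NAMED STATEMENT;
discharged by `defectModuleShape_holds` (sequel file). [cite: Kottwitz1986, §3] [cite: Serre1980Trees, Ch. II §1.1] -/
def DefectModuleShape : Prop :=
  ∀ {K : Type} [Field K] [Valued K ℤᵐ⁰] (σ : K →+* K) (ϖ : K), Valued.v ϖ = WithZero.exp (-1 : ℤ) →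
    ∀ (f : Fin 4 → Fin 3 → (Fin 3 → K)), IsFourFrameFamily σ f → ∀ (b : Fin 4) (g : GL (Fin 3) K),
      ∃ (c₁ c₂ k : ℕ) (u : K), Valued.v u = 1 ∧
        IsLeast {c : ℕ | AxisStable ϖ (frameProj σ (f b 0)) (latt (g : Matrix (Fin 3) (Fin 3) K)) c} c₁ ∧
        IsLeast {c : ℕ | AxisStable ϖ (frameProj σ (f b 1)) (latt (g : Matrix (Fin 3) (Fin 3) K)) c} c₂ ∧
        defectSet (frameProj σ (f b 0)) (frameProj σ (f b 1)) (latt (g : Matrix (Fin 3) (Fin 3) K)) =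
          (Submodule.span 𝒪[K] ({((ϖ ^ c₁ : K), (0 : K)), ((0 : K), (ϖ ^ c₂ : K)),
              (ϖ ^ ((c₁ : ℤ) - k) * u, ϖ ^ ((c₂ : ℤ) - k))} : Set (K × K)) : Set (K × K))

/-- A-2 · AXIS EXPONENT = TREE DISTANCE TO THE SPLIT SUB-BUILDING (v1.4 §2 "c_i = d(Λ, B_i) exactly (checked)"): for every vertex `Λ` of the ★ tree at
`Φ₃`, frame `b`, slot `i`: `c_i(Λ) = dist(Λ, B_i^{(b)})` in ★ `latticeGraph`, `B_i^{(b)} = {vertices M | π_i^{(b)} M ⊆ M}` (the census invariant of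
desk price (ii); `SimpleGraph.dist` is safe because the ★ tree is connected).  SHEET v3 WORDING (LEAD T17-26 (r1), dealer WORD #1 g10-#0): under the EXPLICIT
hypothesis that the ★ lattice graph at `Φ₃` is CONNECTED (discharged at `N = 3` from unit (ii-0) through ★ `isTree_latticeGraph_three_of_transitive`; without it Mathlib's
`SimpleGraph.dist` takes the junk value `0` off the component and the statement would be false as typed).  NAMED STATEMENT; its `≤` half is the tree theorem
★ `axisExponent_le_dist_antidiagonal` (`Summits/…/Theorems/F0P3cDyRamAxisExponentLeTreeDistance`). [cite: Serre1980Trees, Ch. II §1.1] [cite: Kottwitz1986, §3] -/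
def AxisExponentEqTreeDistance : Prop :=
  ∀ {K : Type} [Field K] [Valued K ℤᵐ⁰] [CompleteSpace K] (σ : K →+* K) (ϖ : K) (d t : ℕ), IsRamifiedQuadraticDatum σ ϖ d t →
    (latticeGraph σ ϖ ((StdForm.antidiagonal 3).over K)).Connected →
    ∀ (f : Fin 4 → Fin 3 → (Fin 3 → K)), IsFourFrameFamily σ f →
    ∀ (b : Fin 4) (i : Fin 3) (Λ : Submodule 𝒪[K] (Fin 3 → K)) (hΛ : IsVertex σ ϖ ((StdForm.antidiagonal 3).over K) Λ),
      IsLeast {c : ℕ | AxisStable ϖ (frameProj σ (f b i)) Λ c}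
        (sInf {n : ℕ | ∃ (M : Submodule 𝒪[K] (Fin 3 → K)) (hM : IsVertex σ ϖ ((StdForm.antidiagonal 3).over K) M),
          AxisStable ϖ (frameProj σ (f b i)) M 0 ∧ (latticeGraph σ ϖ ((StdForm.antidiagonal 3).over K)).dist ⟨Λ, hΛ⟩ ⟨M, hM⟩ = n})

end Literature.NumberTheory.Automorphic.UnitaryThreeFourFrame

end
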